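import Summits.AtomisticToContinuum.Crystallization.Theorems.FreeSplittingCertificatesApproxFiniteRangeSplittingP2

/-!
# FreeSplittingCertificates · ApproxFiniteRangeSplitting — part P2D (§9: §D–§E)

Part of the split landing of lens-1 g38 v3 `FreeSplittingCertificatesApproxFiniteRangeSplitting.lean` (sha256 6ca014fa…, 1642 l; module docstring of
record in part 1 `…ApproxFiniteRangeSplitting` / the lens file).  Declarations byte-identical; split for the 400-line rule by prover hand 1, gen 12
(decomp-a2c), --supports stmt-AtomisticToContinuum-12562 (the last part `…Holds` closes it).
-/

namespace Summit.AtomisticToContinuum.Crystallization.Theorems.FreeSplittingCertificatesApproxFiniteRangeSplitting.P2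

open scoped BigOperators
open Classical

noncomputable section

variable (V : ℝ → ℝ) (f : ℝ)

variable (L : ℝ)

/-! ## §D Complementarity `Φ(v,T) + Φ(-v, T - v) = 1` (change of variables `c ↦ c - v`) -/

/-- Coordinates of a point as an offset vector. -/
def vhat (v : E3) : Fin 3 → ℝ := fun k => v k
/-- Auxiliary (lens-1 g38 `ApproxFiniteRangeSplitting` ladder). [folklore] -/

theorem inCube_sub_vhat (c : Fin 3 → ℝ) (u v : E3) :
    InCube L (c - vhat v) u ↔ InCube L c (u + v) := by
  simp only [InCube, Pi.sub_apply, vhat, PiLp.add_apply]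
  refine forall_congr' fun k => ?_
  constructor
  · rintro ⟨h1, h2⟩; constructor <;> linarith
  · rintro ⟨h1, h2⟩; constructor <;> linarith
/-- Auxiliary (lens-1 g38 `ApproxFiniteRangeSplitting` ladder). [folklore] -/

theorem block_sub_vhat (c : Fin 3 → ℝ) (U : Finset E3) (v : E3) :
    block L (c - vhat v) (U.image fun u => u - v) = (block L c U).image fun u => u - v := by
  ext u'
  simp only [mem_block, Finset.mem_image]
  constructor
  · rintro ⟨⟨u, hu, rfl⟩, hc⟩
    refine ⟨u, ⟨hu, ?_⟩, rfl⟩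
    have := (inCube_sub_vhat L c (u - v) v).1 hc
    simpa using this
  · rintro ⟨u, ⟨hu, hc⟩, rfl⟩
    refine ⟨⟨u, hu, rfl⟩, ?_⟩
    rw [inCube_sub_vhat]
    simpa using hc
/-- Auxiliary (lens-1 g38 `ApproxFiniteRangeSplitting` ladder). [folklore] -/

theorem pattern_image (v : E3) (T : Finset E3) :
    insert (0 : E3) (insert (-v) (T.image fun u => u - v)) =
      (insert (0 : E3) (insert v T)).image fun u => u - v := by
  rw [Finset.image_insert, Finset.image_insert, sub_self, zero_sub, Finset.insert_comm]

/-- Equivariance and complementarity hypotheses on the certificate family. -/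
def WShift (W : Finset E3 → E3 → E3 → ℝ) : Prop :=
  ∀ (A : Finset E3), A.Nonempty → ∀ u p q : E3,
    W (A.image fun r => r - u) (p - u) (q - u) = W A p q
/-- Auxiliary (lens-1 g38 `ApproxFiniteRangeSplitting` ladder). [folklore] -/

def WSymm (W : Finset E3 → E3 → E3 → ℝ) : Prop :=
  ∀ (A : Finset E3) (p q : E3), p ∈ A → q ∈ A → p ≠ q → W A p q + W A q p = 1

/-- The pointwise identity behind complementarity. -/
theorem gfun_add_gfun_shift {W : Finset E3 → E3 → E3 → ℝ} (hS : WShift W) (hC : WSymm W)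
    {v : E3} (hv : v ≠ 0) (T : Finset E3) (c : Fin 3 → ℝ) :
    gfun L W v T c + gfun L W (-v) (T.image fun u => u - v) (c - vhat v) =
      (1 / 2 : ℝ) * (corner L 0).indicator (fun _ => (1 : ℝ)) c +
        (1 / 2 : ℝ) * (corner L v).indicator (fun _ => (1 : ℝ)) c := by
  have e0 : InCube L (c - vhat v) 0 ↔ InCube L c v := by
    rw [inCube_sub_vhat, zero_add]
  have ev : InCube L (c - vhat v) (-v) ↔ InCube L c 0 := by
    rw [inCube_sub_vhat, neg_add_cancel]
  unfold gfun
  rw [pattern_image, block_sub_vhat]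
  set B := block L c (insert (0 : E3) (insert v T)) with hB
  by_cases h0 : InCube L c 0 <;> by_cases h1 : InCube L c v
  · -- both endpoints in the cube: W + (1 - W) = 1
    have h0B : (0 : E3) ∈ B := (mem_block L).2 ⟨Finset.mem_insert_self _ _, h0⟩
    have hvB : v ∈ B := (mem_block L).2 ⟨Finset.mem_insert_of_mem (Finset.mem_insert_self _ _), h1⟩
    have hne : B.Nonempty := ⟨0, h0B⟩
    have hshift : W (B.image fun u => u - v) 0 (-v) = W B v 0 := by
      have := hS B hne v v 0
      rwa [sub_self, zero_sub] at this
    rw [if_pos h0, if_pos h1, if_pos (e0.2 h1), if_pos (ev.2 h0), hshift,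
      Set.indicator_of_mem ((mem_corner L).2 h0), Set.indicator_of_mem ((mem_corner L).2 h1)]
    have := hC B 0 v h0B hvB (Ne.symm hv)
    linarith
  · rw [if_pos h0, if_neg h1, if_neg (fun h => h1 (e0.1 h)),
      Set.indicator_of_mem ((mem_corner L).2 h0),
      Set.indicator_of_notMem (fun h => h1 ((mem_corner L).1 h))]
    ring
  · rw [if_neg h0, if_pos (e0.2 h1), if_neg (fun h => h0 (ev.1 h)),
      Set.indicator_of_notMem (fun h => h0 ((mem_corner L).1 h)),
      Set.indicator_of_mem ((mem_corner L).2 h1)]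
    ring
  · rw [if_neg h0, if_neg (fun h => h1 (e0.1 h)),
      Set.indicator_of_notMem (fun h => h0 ((mem_corner L).1 h)),
      Set.indicator_of_notMem (fun h => h1 ((mem_corner L).1 h))]
    ring
/-- Auxiliary (lens-1 g38 `ApproxFiniteRangeSplitting` ladder). [folklore] -/

theorem Phi_complementary {W : Finset E3 → E3 → E3 → ℝ} (hW : WBox W) (hS : WShift W)
    (hC : WSymm W) (hL : 0 < L) {v : E3} (hv : v ≠ 0) (T : Finset E3) :
    Phi L W v T + Phi L W (-v) (T.image fun u => u - v) = 1 := by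
  have hL3 : 0 < L ^ 3 := pow_pos hL 3
  unfold Phi
  rw [← mul_add]
  have hshift : ∫ c, gfun L W (-v) (T.image fun u => u - v) c =
      ∫ c, gfun L W (-v) (T.image fun u => u - v) (c - vhat v) :=
    (MeasureTheory.integral_sub_right_eq_self _ (vhat v)).symm
  rw [hshift, ← MeasureTheory.integral_add (integrable_gfun L hW v T)
    ((integrable_gfun L hW (-v) _).comp_sub_right (vhat v))]
  have hfun : (fun c => gfun L W v T c + gfun L W (-v) (T.image fun u => u - v) (c - vhat v)) =
      fun c => (1 / 2 : ℝ) * (corner L 0).indicator (fun _ => (1 : ℝ)) c +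
        (1 / 2 : ℝ) * (corner L v).indicator (fun _ => (1 : ℝ)) c := by
    funext c; exact gfun_add_gfun_shift L hS hC hv T c
  rw [hfun, MeasureTheory.integral_add, MeasureTheory.integral_const_mul,
    MeasureTheory.integral_const_mul,
    MeasureTheory.integral_indicator_const _ (measurableSet_corner L 0),
    MeasureTheory.integral_indicator_const _ (measurableSet_corner L v), smul_eq_mul, smul_eq_mul,
    MeasureTheory.measureReal_def, MeasureTheory.measureReal_def, volume_corner_toReal L hL.le,
    volume_corner_toReal L hL.le]
  · field_simp
    ring
  · exact (integrable_indicator_corner L 0).const_mul _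
  · exact (integrable_indicator_corner L v).const_mul _


/-! ## §E The boundary strip `{c : 0 ∈ Q_c, v ∉ Q_c}` has volume `≤ L³ · min(1, √3‖v‖/L)` -/

/-- Offsets whose cube contains `0` but not `v`. -/
def strip (v : E3) : Set (Fin 3 → ℝ) := corner L 0 \ corner L v
/-- Auxiliary (lens-1 g38 `ApproxFiniteRangeSplitting` ladder). [folklore] -/

theorem measurableSet_strip (v : E3) : MeasurableSet (strip L v) :=
  (measurableSet_corner L 0).diff (measurableSet_corner L v)
/-- Auxiliary (lens-1 g38 `ApproxFiniteRangeSplitting` ladder). [folklore] -/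

theorem volume_strip_lt_top (v : E3) : MeasureTheory.volume (strip L v) < ⊤ :=
  (MeasureTheory.measure_mono Set.sdiff_subset).trans_lt (volume_corner_lt_top L 0)
/-- Auxiliary (lens-1 g38 `ApproxFiniteRangeSplitting` ladder). [folklore] -/

theorem volume_strip_le_cube (hL : 0 ≤ L) (v : E3) :
    (MeasureTheory.volume (strip L v)).toReal ≤ L ^ 3 := by
  rw [← volume_corner_toReal L hL 0]
  exact ENNReal.toReal_mono (volume_corner_lt_top L 0).ne
    (MeasureTheory.measure_mono Set.sdiff_subset)

/-- Slabs covering the strip: coordinate `k` below `v k - L`, resp. above `v k`. -/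
def slabLo (v : E3) (k : Fin 3) : Set (Fin 3 → ℝ) :=
  Set.univ.pi fun j => Set.Ioc ((fun _ : Fin 3 => -L) j) ((fun j => if j = k then v k - L else 0) j)
/-- Auxiliary (lens-1 g38 `ApproxFiniteRangeSplitting` ladder). [folklore] -/

def slabHi (v : E3) (k : Fin 3) : Set (Fin 3 → ℝ) :=
  Set.univ.pi fun j => Set.Ioc ((fun j => if j = k then v k else -L) j) ((fun _ : Fin 3 => (0 : ℝ)) j)
/-- Auxiliary (lens-1 g38 `ApproxFiniteRangeSplitting` ladder). [folklore] -/

theorem strip_subset (v : E3) : strip L v ⊆ ⋃ k, (slabLo L v k ∪ slabHi L v k) := by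
  intro c hc
  rw [strip, Set.mem_sdiff, mem_corner, mem_corner] at hc
  obtain ⟨h0, hv⟩ := hc
  simp only [InCube, PiLp.zero_apply, zero_sub] at h0
  simp only [InCube, not_forall] at hv
  obtain ⟨k, hk⟩ := hv
  rw [Set.mem_iUnion]
  refine ⟨k, ?_⟩
  by_cases hle : c k ≤ v k - L
  · left
    rw [slabLo, Set.mem_univ_pi]
    intro j
    rw [Set.mem_Ioc]
    dsimp only
    by_cases hj : j = k
    · subst hj; rw [if_pos rfl]; exact ⟨(h0 j).1, hle⟩
    · rw [if_neg hj]; exact h0 j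
  · right
    have hgt : v k < c k := by
      by_contra hge
      exact hk ⟨lt_of_not_ge hle, le_of_not_gt hge⟩
    rw [slabHi, Set.mem_univ_pi]
    intro j
    rw [Set.mem_Ioc]
    dsimp only
    by_cases hj : j = k
    · subst hj; rw [if_pos rfl]; exact ⟨hgt, (h0 j).2⟩
    · rw [if_neg hj]; exact h0 j
/-- Auxiliary (lens-1 g38 `ApproxFiniteRangeSplitting` ladder). [folklore] -/

theorem prod_ite_fin_three (k : Fin 3) (A B : ℝ) :
    ∏ j : Fin 3, (if j = k then A else B) = A * B ^ 2 := by
  fin_cases k <;> simp [Fin.prod_univ_three] <;> ring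
/-- Auxiliary (lens-1 g38 `ApproxFiniteRangeSplitting` ladder). [folklore] -/

theorem volume_pi_Ioc_toReal_max (a b : Fin 3 → ℝ) :
    (MeasureTheory.volume (Set.univ.pi fun j => Set.Ioc (a j) (b j))).toReal =
      ∏ j, max (b j - a j) 0 := by
  rw [Real.volume_pi_Ioc, ENNReal.toReal_prod]
  simp only [ENNReal.toReal_ofReal']
/-- Auxiliary (lens-1 g38 `ApproxFiniteRangeSplitting` ladder). [folklore] -/

theorem volume_pi_Ioc_ne_top (a b : Fin 3 → ℝ) :
    MeasureTheory.volume (Set.univ.pi fun j => Set.Ioc (a j) (b j)) ≠ ⊤ := by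
  rw [Real.volume_pi_Ioc]
  exact ENNReal.prod_ne_top fun j _ => ENNReal.ofReal_ne_top
/-- Auxiliary (lens-1 g38 `ApproxFiniteRangeSplitting` ladder). [folklore] -/

theorem volume_slabLo_toReal (hL : 0 < L) (v : E3) (k : Fin 3) :
    (MeasureTheory.volume (slabLo L v k)).toReal = max (v k) 0 * L ^ 2 := by
  rw [slabLo, volume_pi_Ioc_toReal_max]
  have : (fun j : Fin 3 => max ((if j = k then v k - L else 0) - -L) 0) =
      fun j => if j = k then max (v k) 0 else L := by
    funext j
    by_cases hj : j = k
    · rw [if_pos hj, if_pos hj]; congr 1; ring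
    · rw [if_neg hj, if_neg hj, zero_sub, neg_neg, max_eq_left hL.le]
  rw [this, prod_ite_fin_three]
/-- Auxiliary (lens-1 g38 `ApproxFiniteRangeSplitting` ladder). [folklore] -/

theorem volume_slabHi_toReal (hL : 0 < L) (v : E3) (k : Fin 3) :
    (MeasureTheory.volume (slabHi L v k)).toReal = max (-v k) 0 * L ^ 2 := by
  rw [slabHi, volume_pi_Ioc_toReal_max]
  have : (fun j : Fin 3 => max ((0 : ℝ) - (if j = k then v k else -L)) 0) =
      fun j => if j = k then max (-v k) 0 else L := by
    funext j
    by_cases hj : j = k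
    · rw [if_pos hj, if_pos hj, zero_sub]
    · rw [if_neg hj, if_neg hj, zero_sub, neg_neg, max_eq_left hL.le]
  rw [this, prod_ite_fin_three]
/-- Auxiliary (lens-1 g38 `ApproxFiniteRangeSplitting` ladder). [folklore] -/

theorem volume_slabLo_ne_top (v : E3) (k : Fin 3) : MeasureTheory.volume (slabLo L v k) ≠ ⊤ :=
  volume_pi_Ioc_ne_top _ _
/-- Auxiliary (lens-1 g38 `ApproxFiniteRangeSplitting` ladder). [folklore] -/

theorem volume_slabHi_ne_top (v : E3) (k : Fin 3) : MeasureTheory.volume (slabHi L v k) ≠ ⊤ :=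
  volume_pi_Ioc_ne_top _ _
/-- Auxiliary (lens-1 g38 `ApproxFiniteRangeSplitting` ladder). [folklore] -/

theorem volume_strip_le_sum (hL : 0 < L) (v : E3) :
    (MeasureTheory.volume (strip L v)).toReal ≤ L ^ 2 * ∑ k, |v k| := by
  have hfin : ∀ k, MeasureTheory.volume (slabLo L v k ∪ slabHi L v k) ≠ ⊤ := fun k =>
    ((MeasureTheory.measure_union_le _ _).trans_lt (ENNReal.add_lt_top.2
      ⟨(volume_slabLo_ne_top L v k).lt_top, (volume_slabHi_ne_top L v k).lt_top⟩)).ne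
  calc (MeasureTheory.volume (strip L v)).toReal
      ≤ (∑ k, MeasureTheory.volume (slabLo L v k ∪ slabHi L v k)).toReal := by
        refine ENNReal.toReal_mono (ENNReal.sum_ne_top.2 fun k _ => hfin k) ?_
        exact (MeasureTheory.measure_mono (strip_subset L v)).trans
          (MeasureTheory.measure_iUnion_fintype_le _ _)
    _ = ∑ k, (MeasureTheory.volume (slabLo L v k ∪ slabHi L v k)).toReal :=
        ENNReal.toReal_sum fun k _ => hfin k
    _ ≤ ∑ k, ((MeasureTheory.volume (slabLo L v k)).toReal +
          (MeasureTheory.volume (slabHi L v k)).toReal) := by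
        refine Finset.sum_le_sum fun k _ => ?_
        rw [← ENNReal.toReal_add (volume_slabLo_ne_top L v k) (volume_slabHi_ne_top L v k)]
        exact ENNReal.toReal_mono
          (ENNReal.add_ne_top.2 ⟨volume_slabLo_ne_top L v k, volume_slabHi_ne_top L v k⟩)
          (MeasureTheory.measure_union_le _ _)
    _ = ∑ k, |v k| * L ^ 2 := by
        refine Finset.sum_congr rfl fun k _ => ?_
        rw [volume_slabLo_toReal L hL, volume_slabHi_toReal L hL, ← add_mul,
          max_zero_add_max_neg_zero_eq_abs_self]
    _ = L ^ 2 * ∑ k, |v k| := by rw [← Finset.sum_mul, mul_comm]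
/-- Auxiliary (lens-1 g38 `ApproxFiniteRangeSplitting` ladder). [folklore] -/

theorem sum_abs_le_sqrt_three_mul_norm (v : E3) : ∑ k, |v k| ≤ Real.sqrt 3 * ‖v‖ := by
  have hsq : ‖v‖ ^ 2 = ∑ k, (v k) ^ 2 := EuclideanSpace.real_norm_sq_eq v
  have hn : 0 ≤ ‖v‖ := norm_nonneg v
  have hsum : 0 ≤ ∑ k, |v k| := Finset.sum_nonneg fun k _ => abs_nonneg _
  have h3 : (∑ k, |v k|) ^ 2 ≤ 3 * ‖v‖ ^ 2 := by
    rw [hsq, Fin.sum_univ_three, Fin.sum_univ_three, ← sq_abs (v 0), ← sq_abs (v 1), ← sq_abs (v 2)]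
    nlinarith [sq_nonneg (|v 0| - |v 1|), sq_nonneg (|v 0| - |v 2|), sq_nonneg (|v 1| - |v 2|)]
  have hs3 : (0 : ℝ) ≤ Real.sqrt 3 := Real.sqrt_nonneg 3
  have h33 : Real.sqrt 3 * Real.sqrt 3 = 3 := Real.mul_self_sqrt (by norm_num)
  nlinarith [sq_nonneg (∑ k, |v k| - Real.sqrt 3 * ‖v‖), mul_nonneg hs3 hn]
/-- Auxiliary (lens-1 g38 `ApproxFiniteRangeSplitting` ladder). [folklore] -/

theorem volume_strip_le (hL : 0 < L) (v : E3) :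
    (MeasureTheory.volume (strip L v)).toReal ≤ L ^ 3 * min 1 (Real.sqrt 3 * ‖v‖ / L) := by
  rcases le_total 1 (Real.sqrt 3 * ‖v‖ / L) with h | h
  · rw [min_eq_left h, mul_one]; exact volume_strip_le_cube L hL.le v
  · rw [min_eq_right h]
    calc (MeasureTheory.volume (strip L v)).toReal ≤ L ^ 2 * ∑ k, |v k| := volume_strip_le_sum L hL v
      _ ≤ L ^ 2 * (Real.sqrt 3 * ‖v‖) :=
          mul_le_mul_of_nonneg_left (sum_abs_le_sqrt_three_mul_norm v) (sq_nonneg L)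
      _ = L ^ 3 * (Real.sqrt 3 * ‖v‖ / L) := by field_simp

end

end Summit.AtomisticToContinuum.Crystallization.Theorems.FreeSplittingCertificatesApproxFiniteRangeSplitting.P2
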